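import Summits.AtomisticToContinuum.HydrodynamicLimit.Theorems.AntiMazurCoboundariesCorrectorPressureDecayKiferCellTranslation
import Mathlib.Probability.ConditionalProbability

/-! Scratch: wave-5 signatures — general-box versions (B1'), (B2') of the free-measure count estimates, the per-box exact-count bound (B4'),
and the shared definition `c9Box`. -/

noncomputable section

open MeasureTheory ProbabilityTheory Set Filter Topology InformationTheory
open scoped ENNReal NNReal

namespace Summit.AtomisticToContinuum.HydrodynamicLimit.Theorems.KiferCompactification

open Literature.MathematicalPhysics.KineticTheory (T3 V3 hsDiameter localGibbsLaw blowUpPoint blowUp)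
open Literature.MathematicalPhysics.KineticTheory.HardSphereDLR (gibbsSpecMeasure)
open Literature.MathematicalPhysics.KineticTheory.PointProcess (windowLaw windowRestrict centredBox density)
open Literature.Analysis.FluidPDE (HardSphereFlow Config IsHardCore IsHardSphereGibbs IsTranslationInvariant)
open Literature.Analysis.FunctionSpaces (PointConfig)

/-- The closed axis-parallel BOX of side `ℓ` with lower corner `a`: `{y | ∀ i, y i ∈ [a i, a i + ℓ]}` (the cores `c9CellCore` of the cells
are such boxes: `c9CellCore S m j = c9Box (corner + 1) (S/m - 2)`). -/
def c9Box (a : V3) (ℓ : ℝ) : Set V3 :=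
  {y | ∀ i, y i ∈ Icc (a i) (a i + ℓ)}

/-- W5-1 (B1'): mean particle number of a free BOX of any real side `ℓ ≥ 1` and any position vs the density of the Gibbs state. -/
theorem c9_free_box_mean_count_sub_le {z β : ℝ} {u : V3} (hz : 0 < z) (hz1 : z ≤ 1 / 64) (hβ : 0 < β)
    {G : Measure (PointConfig (V3 × V3))} (hG : IsHardSphereGibbs 1 z β u G) (hGT : IsTranslationInvariant G) :
    ∃ C : ℝ, ∀ (a : V3) (ℓ : ℝ), 1 ≤ ℓ →
      |(∫⁻ ω, ((ω.count univ : ℕ∞) : ℝ≥0∞) ∂(gibbsSpecMeasure 1 z β u (c9Box a ℓ) ∅)).toReal - (density G).toReal * ℓ ^ 3| ≤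
        C * ℓ ^ 2 := by
  sorry

/-- W5-2 (B2'): variance of the particle number of a free BOX of any real side `ℓ ≥ 1` and any position. -/
theorem c9_free_box_count_variance_le {z β : ℝ} {u : V3} (hz : 0 < z) (hz1 : z ≤ 1 / 64) (hβ : 0 < β) :
    ∃ C : ℝ, ∀ (a : V3) (ℓ : ℝ), 1 ≤ ℓ →
      ∫ ω, ((((ω.count univ : ℕ∞) : ℝ≥0∞).toReal) -
          ∫ ω', (((ω'.count univ : ℕ∞) : ℝ≥0∞).toReal) ∂(gibbsSpecMeasure 1 z β u (c9Box a ℓ) ∅)) ^ 2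
        ∂(gibbsSpecMeasure 1 z β u (c9Box a ℓ) ∅) ≤ C * ℓ ^ 3 := by
  sorry

/-- W5-3 (B4'): the EXACT-COUNT lower bound: a free box of large side gives every particle number within `2ℓ² + 10` of `density(G)·ℓ³`
probability at least `exp(-η ℓ³)`. -/
theorem c9_free_box_count_ge_exp_neg {z β : ℝ} {u : V3} (hz : 0 < z) (hz1 : z ≤ 1 / 64) (hβ : 0 < β)
    {G : Measure (PointConfig (V3 × V3))} (hG : IsHardSphereGibbs 1 z β u G) (hGT : IsTranslationInvariant G)
    {η : ℝ} (hη : 0 < η) :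
    ∃ ℓ₀ : ℝ, 0 < ℓ₀ ∧ ∀ (a : V3) (ℓ : ℝ), ℓ₀ ≤ ℓ → ∀ k : ℕ, |(k : ℝ) - (density G).toReal * ℓ ^ 3| ≤ 2 * ℓ ^ 2 + 10 →
      ENNReal.ofReal (Real.exp (-(η * ℓ ^ 3))) ≤ gibbsSpecMeasure 1 z β u (c9Box a ℓ) ∅ {ω | ω.count univ = k} := by
  sorry

end Summit.AtomisticToContinuum.HydrodynamicLimit.Theorems.KiferCompactification

end
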